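import Literature.NumberTheory.EllipticCurves.IwasawaAlgebraProofs
import Literature.NumberTheory.EllipticCurves.IwasawaAlgebraCharIdealProofs
import HarnessLib

/-!
# The localized image of Kato's zeta module is a THEOREM of two print-verbatim integral shadows
# (algebra behind the F1 field `Kato2004.DivisibilityInputs.image_zeta_localized`; print cell
# `bsd-print-x9`, seat p3; referee ruling RUL-3 — theorems only, nothing booked)

Context (HOME/p3/F1-IMAGE-ZETA-AT-P.md; REF-AUDIT §1d RUL-2/RUL-3 of cell `bsd-print-x9`). The
published input F1 = `Kato2004.exists_divisibilityInputs_fineQuotient_zeta` (Kato, Astérisque 295, the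
§17.13 package on `(𝐇¹_Γ(T_pE), X(E/ℚ_∞))`) carries a field `image_zeta_localized`: for `G₁ ∈ Λ` with
`ι G₁ = L_p(E,T)` and EVERY height-one prime `𝔭` of `Λ = ℤ_p⟦T⟧`, some `s ∉ 𝔭` has
`s · G₁ ∈ col(loc Z)` and `s · col(loc z) ∈ (G₁)` for all `z ∈ Z` (`Z` = the span of the integral
zeta elements, Thm. 12.6; `col` = the Coleman map of Prop. 17.11; `loc` of (17.13.1)). The cell
referee first read this at `𝔭 = (p)` as exceeding print (Kato p. 280 opens with (12.5.2) when
`𝔭 ∋ p`), then (RUL-3) concurred with the seat's derivation: the identification is COMPOSITE OF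
PRINTED statements — Thm. 12.6 (`Z ⊂ Z(f,T)` with FINITE index, hence `𝔪^m Z(f,T) ⊂ Z`), Thm.
12.5 (1)(2) (linearity of `γ ↦ z_γ`), Thm. 16.6 (2) + Prop. 17.11 + 17.5 (`col(loc z_γ) =
L_{p-adic,α,ω,γ}`; with the period unit A25 and GV Prop. 3.7, `col(loc Z(f,T)) = Λ·u·G₁`, `u` a unit)
— (12.5.2) pricing only Thm. 12.5 (4). This file is the KERNEL form of the algebra in that
derivation, stated over ABSTRACT `Λ`-modules so that a restated package can cite it by name:

* hypotheses (the two INTEGRAL SHADOWS proposed to the typer, using only the package's objects):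
  (F1a) «zeta line through 12.6's finite index»: naturals `m`, a unit `u`, elements `wp, wT ∈ Z` with
  `col(loc wp) = p^m·u·G₁`, `col(loc wT) = T^m·u·G₁` (reading: `wp = p^m z_{γ₀}`, `wT = T^m z_{γ₀}`; the
  relation `T^m • wp = p^m • wT` belongs to the shadow but is not used by the derivation); (F1b) «`Z ⊂ Z(f,T)` and `col(loc Z(f,T)) = Λ·u·G₁`»: `col(loc z) ∈ (G₁)` for
  all `z ∈ Z`;
* conclusion `imageLocalized_of_zetaLine`: the field `image_zeta_localized` verbatim, at EVERY
  height-one `𝔭` — at `𝔭 = (p)` with the witness `s = T^m` (a height-one prime containing `p` IS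
  `(p)`, `eq_augIdealP_of_height_eq_one_of_C_mem`, and `T ∉ (p)`), at `𝔭 ∌ p` with `s = p^m`.

Pure commutative algebra in `Λ` (`(p)` is a height-one prime: tree theorems `isPrime_augIdealP_holds`,
`height_augIdealP_holds`; Mathlib `Ideal.eq_of_le_of_height_le`). No named fact, no elliptic curve.

References: [Kato2004Asterisque] Thm. 12.5 (1)(2)(4), Thm. 12.6 (p. 222), Thm. 16.6 (p. 271), 17.5
(p. 274), Prop. 17.11 (p. 277), §17.13 (pp. 279–280); [Washington1997] §13.1–13.2.
-/

set_option linter.dupNamespace false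
set_option autoImplicit false

noncomputable section

open Literature.NumberTheory.EllipticCurves Literature.NumberTheory.EllipticCurves.IwasawaAlgebra

namespace Summit.BirchSwinnertonDyer.BirchSwinnertonDyer.Rank1Residual.ZetaImage

variable {p : ℕ} [Fact p.Prime]

/-- **A height-one prime of `Λ = ℤ_p⟦T⟧` containing `p` is `(p)`**: `(p)` is prime of height one
(`isPrime_augIdealP_holds`, `height_augIdealP_holds`), and a prime strictly above a height-one prime
has height `≥ 2` (`Ideal.eq_of_le_of_height_le`). [cite: Washington1997, §13.2] -/
theorem eq_augIdealP_of_height_eq_one_of_C_mem (𝔭 : PrimeSpectrum (IwasawaAlgebra p))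
    (h1 : 𝔭.asIdeal.height = 1) (hp : (PowerSeries.C (p : ℤ_[p]) : IwasawaAlgebra p) ∈ 𝔭.asIdeal) :
    𝔭.asIdeal = augIdealP p := by
  haveI : (augIdealP p).IsPrime := isPrime_augIdealP_holds p
  have hle : augIdealP p ≤ 𝔭.asIdeal := by
    rw [augIdealP, Ideal.span_singleton_le_iff_mem]
    exact hp
  have hh : 𝔭.asIdeal.height ≤ (augIdealP p).height := by
    rw [h1, show (augIdealP p).height = 1 from height_augIdealP_holds p]
  exact (Ideal.eq_of_le_of_height_le (augIdealP p) hle hh).symm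

/-- **`T ∉ (p)`** in `ℤ_p⟦T⟧` (its coefficient of `T¹` is `1`, not divisible by `p`). [folklore] -/
theorem X_notMem_augIdealP : (PowerSeries.X : IwasawaAlgebra p) ∉ augIdealP p := by
  intro h
  have h1 := (mem_augIdealP_iff (p := p) PowerSeries.X).mp h 1
  rw [PowerSeries.coeff_one_X] at h1
  exact (PadicInt.irreducible_p (p := p)).not_isUnit (isUnit_of_dvd_one h1)

/-- **`T^m ∉ 𝔭` for a height-one prime `𝔭 ∋ p`** (then `𝔭 = (p)`, prime, and `T ∉ (p)`). [folklore] -/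
theorem X_pow_notMem_of_height_eq_one_of_C_mem (𝔭 : PrimeSpectrum (IwasawaAlgebra p))
    (h1 : 𝔭.asIdeal.height = 1) (hp : (PowerSeries.C (p : ℤ_[p]) : IwasawaAlgebra p) ∈ 𝔭.asIdeal)
    (m : ℕ) : (PowerSeries.X : IwasawaAlgebra p) ^ m ∉ 𝔭.asIdeal := by
  intro h
  have hX := 𝔭.isPrime.mem_of_pow_mem m h
  rw [eq_augIdealP_of_height_eq_one_of_C_mem 𝔭 h1 hp] at hX
  exact X_notMem_augIdealP hX

/-- **`p^m ∉ 𝔭` for a prime `𝔭 ∌ p`.** [folklore] -/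
theorem C_pow_notMem_of_C_notMem (𝔭 : PrimeSpectrum (IwasawaAlgebra p))
    (hp : (PowerSeries.C (p : ℤ_[p]) : IwasawaAlgebra p) ∉ 𝔭.asIdeal) (m : ℕ) :
    (PowerSeries.C (p : ℤ_[p]) : IwasawaAlgebra p) ^ m ∉ 𝔭.asIdeal :=
  fun h ↦ hp (𝔭.isPrime.mem_of_pow_mem m h)

/-- **The localized image of the zeta module from the two integral shadows.** Let `H, P` be
`Λ`-modules (`Λ = ℤ_p⟦T⟧`; reading: `H = 𝐇¹_Γ(T)`, `P` the local quotient of (17.13.3)), `loc : H → P`,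
`col : P → Λ` linear (the localisation and the Coleman map of Prop. 17.11), `Z ≤ H` (the span of the
integral zeta elements, Thm. 12.6) and `G₁ ∈ Λ` (the integral `p`-adic `L`-function). Assume
(F1a) `wp, wT ∈ Z`, `col(loc wp) = p^m·u·G₁`, `col(loc wT) = T^m·u·G₁` with `u` a unit (the relation
`T^m • wp = p^m • wT` of the shadow is not needed here) — the INTEGRAL SHADOW of "there is `z_{γ₀} ∈ H ⊗ ℚ` with `col(loc z_{γ₀}) = u·G₁` (Thm. 16.6 (2),
Prop. 17.11, 17.5, the period unit) and `𝔪^m·Z(f,T) ⊂ Z` (Thm. 12.6: finite index)"; and (F1b)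
`col(loc z) ∈ (G₁)` for every `z ∈ Z` — "`Z ⊂ Z(f,T)` (12.6) and `col(loc Z(f,T)) = Λ·u·G₁` (12.5 (1)
linearity)". THEN for every height-one prime `𝔭` there is `s ∉ 𝔭` with `s·G₁ ∈ col(loc Z)` and
`s·col(loc z) ∈ (G₁)` for all `z ∈ Z` — the field `image_zeta_localized` of
`Kato2004.DivisibilityInputs`, verbatim. Witnesses: `s = u⁻¹·T^m` (via `wT`) if `p ∈ 𝔭` (then
`𝔭 = (p) ∌ T^m`), `s = u⁻¹·p^m` (via `wp`) otherwise. No (12.5.2) anywhere: that hypothesis of Kato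
p. 280 prices Thm. 12.5 (4), which this statement does not use.
[cite: Kato2004Asterisque, Thm. 12.6 (p. 222), Thm. 16.6 (2) (p. 271), Prop. 17.11 (p. 277) and §17.13 (p. 280)]
[cite: Washington1997, §13.2] -/
theorem imageLocalized_of_zetaLine {H P : Type*} [AddCommGroup H] [Module (IwasawaAlgebra p) H]
    [AddCommGroup P] [Module (IwasawaAlgebra p) P]
    (loc : H →ₗ[IwasawaAlgebra p] P) (col : P →ₗ[IwasawaAlgebra p] IwasawaAlgebra p)
    (Z : Submodule (IwasawaAlgebra p) H) (G₁ : IwasawaAlgebra p)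
    (m : ℕ) (u : (IwasawaAlgebra p)ˣ) (wp wT : H) (hwp : wp ∈ Z) (hwT : wT ∈ Z)
    (hcol_wp : col (loc wp) = (PowerSeries.C (p : ℤ_[p]) : IwasawaAlgebra p) ^ m * u * G₁)
    (hcol_wT : col (loc wT) = (PowerSeries.X : IwasawaAlgebra p) ^ m * u * G₁)
    (hZ : ∀ z ∈ Z, col (loc z) ∈ Ideal.span {G₁}) :
    ∀ 𝔭 : PrimeSpectrum (IwasawaAlgebra p), 𝔭.asIdeal.height = 1 →
      ∃ s : IwasawaAlgebra p, s ∉ 𝔭.asIdeal ∧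
        s * G₁ ∈ Submodule.map (col ∘ₗ loc) Z ∧
        ∀ z ∈ Z, s * col (loc z) ∈ Ideal.span {G₁} := by
  intro 𝔭 h1
  -- the second clause holds for ANY `s` by (F1b)
  have hclause2 : ∀ (s : IwasawaAlgebra p), ∀ z ∈ Z, s * col (loc z) ∈ Ideal.span {G₁} :=
    fun s z hz ↦ Ideal.mul_mem_left _ s (hZ z hz)
  -- a witness `w ∈ Z` with `col(loc w) = t·u·G₁` gives the first clause for `s = u⁻¹… `; we use
  -- `s := t` and absorb the unit: `t·G₁ = u⁻¹ · col(loc w) = col(loc (u⁻¹ • w))`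
  have hclause1 : ∀ (t : IwasawaAlgebra p) (w : H), w ∈ Z → col (loc w) = t * u * G₁ →
      t * G₁ ∈ Submodule.map (col ∘ₗ loc) Z := by
    intro t w hw hcw
    refine ⟨(↑u⁻¹ : IwasawaAlgebra p) • w, Z.smul_mem _ hw, ?_⟩
    rw [LinearMap.comp_apply, map_smul, map_smul, hcw, smul_eq_mul]
    calc (↑u⁻¹ : IwasawaAlgebra p) * (t * ↑u * G₁) = t * ((↑u⁻¹ : IwasawaAlgebra p) * ↑u) * G₁ := by
          ring
      _ = t * G₁ := by rw [Units.inv_mul, mul_one]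
  by_cases hp : (PowerSeries.C (p : ℤ_[p]) : IwasawaAlgebra p) ∈ 𝔭.asIdeal
  · -- `𝔭 = (p)`: witness `T^m` through `wT`
    exact ⟨(PowerSeries.X : IwasawaAlgebra p) ^ m, X_pow_notMem_of_height_eq_one_of_C_mem 𝔭 h1 hp m,
      hclause1 _ wT hwT hcol_wT, hclause2 _⟩
  · -- `𝔭 ∌ p`: witness `p^m` through `wp`
    exact ⟨(PowerSeries.C (p : ℤ_[p]) : IwasawaAlgebra p) ^ m, C_pow_notMem_of_C_notMem 𝔭 hp m,
      hclause1 _ wp hwp hcol_wp, hclause2 _⟩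

end Summit.BirchSwinnertonDyer.BirchSwinnertonDyer.Rank1Residual.ZetaImage

end
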